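import Literature.MathematicalPhysics.QuantumFieldTheory.Balaban1983to89.T4ApexCanonical
import Literature.MathematicalPhysics.QuantumFieldTheory.Balaban1983to89.T4PathMeanHybrid

/-!
# RUNG (B)+1: SECOND LEAF OF THE CANONICAL CENSUS — NE7-M ⇔ NE7-V UNDER THE TARGETS' PREFIX WITH THE CLAUSES INCLUDED, THE
# RATE-CLOTHED FORM OF THE FIELD-LEVEL HYBRID NE7-H, AND (v1.1, §4) THE HYBRID IN THE MEAN NE7-HM = NE7-TV ∧ TILT UNDER THE PREFIX
# (apex lineage `T4Continuum` → `T4Apex` → `T4ApexTwoLevel` → `T4ApexHybrid` → `T4ApexPrinted` → `T4ApexVariance` → `T4ApexCanonical` → this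
# LEAF; ADDITIVE — no existing module is modified; no importer inside `Balaban1983to89/`; cell `pub-balaban`, scoping sub-cell `t4`, unit
# `b2b-balaban-t4-lean` gen 22 (v1) / gen 23 (v1.1); journal rows T4-T.L-APEX-CANON2* / T4-T.L-APEX-CANON2-v1.1*)

STATEMENTS AND QUANTIFIER BOOKKEEPING ONLY: every theorem of this file is a short composition of theorems already in the tree; nothing about the renormalization
programme is proved or asserted, every declaration is tagged [folklore], sorry-free.  HONEST FRAMING exactly as in the certified header of
`…T4ApexCanonical` (the Clay problem description's sentence on the TWO limits, [JaffeWittenClay2006] §6.5 p. 11, carried verbatim THERE and in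
`…Missing` §2, not re-quoted here): this file concerns ONLY the `ε → 0` limit of the joint expectations of unit-scale averaged gauge-invariant
Wilson-loop variables on ONE four-torus of fixed physical size, UNDER (B) = [Balaban1989LargeFieldII] Thm 1 (pinned, `B16.EndStatementBPrinted`)
and a β-function hypothesis, both carried INSIDE every target as antecedents and never discharged.  NOT infinite volume, NOT a mass gap, NOT
non-triviality, NOT the Clay problem.  The four targets stay OPEN `Prop`s; value = typed skeleton and census by name; NOT summit progress.

CITATION HEADER (lean-in-tree rule 2026-08-18).  No statement of Bałaban's series — or of any printed source — is asserted or quoted in this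
file.  The hypothesis SHAPES consumed — `T4ApexCanonical.CanonicalPathVarianceUnder` (canonical NE7-V under the prefix: a summable path-variance
rate of the relative effective actions of consecutive runs), `.CanonicalTiltMomentUnder` / `.CanonicalTiltMomentSplitUnder` (canonical NE7-M:
summable-root majorants of the centred second moments of the consecutive Gibbs tilts), `.CanonicalTiltSandwichUnder` / `.CanonicalTiltSandwichGBUnder`
/ `.CanonicalTiltSandwichGB₀Under` (NE7-S / NE7-SGB / NE7-SGB₀) and `.CanonicalTermHybridUnder` (NE7-H: the carved two-class hybrid of the term
densities read at field level, clause `Σ r_K < ∞ ∧ Σ W_K < ∞`), with the scheme-level shapes of `T4PathVarianceRate` behind them — are those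
modules' typing of estimates that are NOT PRINTED for Bałaban's scheme (their headers; GAPS G-ne7p3-1/2/4/7); here they are only joined to one
another under the targets' quantifier prefix `T4Continuum.FiniteEpsData.UnderHypotheses` and NEVER asserted of any datum.  The producer
theorem NE7-V ⇒ NE7-M with `(M, M′) = (v², 2v²(1+v²))` (`T4PathVarianceRate.canonicalEffTiltMoment_of_canonicalEffPathVarianceRate`, v1.4 §8.6,
t4-ne7-p3) and the clause lemmas `T4PathVarianceWeightSplit.summable_mRate_iff` (v1.2 §4) / `.exists_effTermHybrid_summable_iff` (v1.4 §5) /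
`.summable_mRate_sq_iff` (v1.5 §4.6: drafted by this seat in gen 22 and hosted upstream by the module's owner t4-ne7-p2 — journal NOTE l.59216,
p193011; one writer per module) are real analysis RE-PROVED over Mathlib in those modules and cite no print; they enter BY NAME only.
(v1.1, §4) The hybrid IN THE MEAN `T4PathMeanHybrid.EffMeanHybrid` / `.CanonicalEffMeanHybrid` (NE7-HM: the two-run tilt sandwich holding only
DEFECTIVELY, with measurable defects whose MEANS under each run's own law are `≤ W_K`, `≤ W'_K`), its term-wise socket `.EffTermMeanHybrid`
(NE7-HMT), the rate `meanHybridRate r W W' = 2r + W + W'`, the producers NE7-S / NE7-H ⇒ NE7-HM, the TV bound `effTVRate_of_effMeanHybrid` and the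
clause-level converse `exists_effMeanHybrid_summable_iff` (summable NE7-HM ⟺ summable NE7-TV ∧ the tilt relation) are that module's (t4-ne7-p3
gen 10; v1 p193082, kept by name and signature in v1.1 p193361) typing of an estimate NOT PRINTED for Bałaban's scheme (its header; GAPS
G-ne7p3-7) and real analysis RE-PROVED over Mathlib citing no print; they enter §4 BY NAME only.  The consumer bindings of §4 follow that module
owner's kernel-checked consumer probe (scratch `ConsumerProbe.lean` sha256[:16] 476cc5f83c330479, cell journal NOTE of 2026-08-19), re-typed in
this namespace.

ABSOLUTE RULE OBSERVED: no internally-minted statement enters as a cited fact; every hypothesis of every theorem below is a NAMED SHAPE (an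
open `Prop`, never asserted) or a field / class theorem of the data; no programme-internal claim (2001 / route / tribunal / the manuscripts
under audit for their own disputed steps) is cited.

WHY A SECOND LEAF.  `T4ApexCanonical.lean` v1.4 is 196 688 bytes, within 3 312 bytes of the gate's 200 000-byte module limit; further
bindings of the canonical census therefore live HERE, in a leaf that no module of `Balaban1983to89/` imports, importing at v1 ONLY
`T4ApexCanonical` (project import cone = that module's, grown by nothing) and since v1.1 ALSO the sibling `T4PathMeanHybrid` (t4-ne7-p3; it imports
only `T4PathVarianceRate`, already in the parent's cone, so the cone grows by exactly that one module — `DIVERGENCE.md` D-t4l.29); the apex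
`T4ApexVariance`, t4-pkg's `T4ContinuumYM4Torus` and every other module untouched.  The root import list `lean/Literature.lean` is managed by the
gate and imports this leaf and its parent LIVE (v1's inherited sentence on a commented root import was wrong at v1's landing already: cross-read
GAPS-T4 C-t4r3-47 R1, folded `GAPS.md` C-t4l-65).

CENSUS BY NAME — what this leaf adds to `T4ApexCanonical` v1.4 §9.4 / §10.2 (all `Hβ`; antecedents NOT PRINTED):
 * §1  **NE7-M ⇔ NE7-V UNDER THE PREFIX, CLAUSES INCLUDED** (`canonicalTiltMomentUnder_iff_canonicalPathVarianceUnder`): v1.4 §9.4 had NE7-M ⇒ NE7-V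
   (`canonicalPathVarianceUnder_of_canonicalTiltMomentUnder`) and NE7-V ⇒ NE7-M only «sans clause» (`underHypotheses_canonicalEffTiltMoment_of_
   canonicalPathVarianceUnder`: the V-clause `Summable v` displayed, no M-clause produced).  `T4PathVarianceWeightSplit` now supplies the real analysis BY NAME: the M-clause AT
   THE PRODUCED MOMENTS, `Summable (mRate (v²) (2v²(1+v²)))`, holds IFF `Summable v` (`T4PathVarianceWeightSplit.summable_mRate_sq_iff`; no sign hypothesis).  Hence also
   `CanonicalTiltMomentSplitUnder ⇔ CanonicalPathVarianceUnder` and the one-step names NE7-SGB ⇒ NE7-M, NE7-SGB₀ ⇒ NE7-M (compositions).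
 * §2  **THE RATE-CLOTHED NE7-H** `CanonicalTermHybridRateUnder` (clause `Σ_K fieldHybridRate r W K < ∞`, the produced NE7-S rate) `⇔`
   `CanonicalTermHybridUnder` (clause `Σ r_K < ∞ ∧ Σ W_K < ∞`) `⇔ CanonicalTiltSandwichUnder` — by name from
   `T4PathVarianceWeightSplit.exists_effTermHybrid_summable_iff` at `T4RunLadder.unitFactorisation D hM g₀`; its consequences (NE7-V, NE7-M, the
   limiting law WITH THE CLAUSE CARRIED in the output existential — also in the split-clause form, the primed sibling v1.4 §10.2 omitted —, the
   existence target, all four targets on printed-averaged `SU(N)` data, the headline `T4Apex.YM4TorusContinuumPrintedSU N`) by name.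
 * §3  census conjunction + the inhabited-vacuous witness on the printed one-level class (pattern of v1.4 §10.3).
 * §4  (v1.1) **THE HYBRID IN THE MEAN NE7-HM UNDER THE PREFIX** by name from `T4PathMeanHybrid`: the shapes `CanonicalMeanHybridUnder D hM Hβ`
   (clause `Σ r < ∞ ∧ Σ W < ∞ ∧ Σ W' < ∞`, shape `CanonicalEffMeanHybrid D hM g₀ r W W'`), the term-wise socket `CanonicalTermMeanHybridUnder`
   (NE7-HMT ⇒ NE7-HM at the SAME rates) and `CanonicalEffTVRateTiltUnder` (v1.x's `CanonicalEffTVRateUnder` ∧ the tilt relation of consecutive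
   canonical laws); the ORDER INTO NE7-HM — NE7-S (no defects), NE7-H split- / rate-clothed (rate `fieldHybridRate`), NE7-V (witness `(0, v, v)`:
   NE7-TV at rate `v` + the shape's own tilt), NE7-M (through NE7-V), NE7-A (witness `(0, δ, δ)`, `δ = 2e^{2R}σ`) ⇒ NE7-HM —; the kernel `↔`
   **`canonicalMeanHybridUnder_iff_canonicalEffTVRateTiltUnder`: NE7-HM-Under ⇔ NE7-TV-Under ∧ tilt** (`exists_effMeanHybrid_summable_iff` at
   `scheme_β_nonneg`; ⇒ at rate `meanHybridRate = 2r + W + W'`, ⇐ with `(0, t, t)`) — NO HIDDEN STRENGTH: under the prefix too the mean hybrid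
   sits ON the TV rung; the ORDER OUT — NE7-TV, the limiting law of the data, `EffTVRateUnder`, `MatchingUnder`, `GenFunCauchyUnder` (radius 1),
   `StringwiseUnder` —; node U5's OUTPUT at every radius (remainder `e^{2l₀}·2·meanHybridRate`) and THE LIMITING LAW (`ν ≪ domMeasure effLaw`,
   tail `B·Σ_j 2·meanHybridRate r W W' (j+K)`) WITH THE CLAUSE CARRIED; the existence target(′) (also from the socket), all four targets for
   printed `SU(N)` / (0.4) data, the headline `printedSU_of_canonicalMeanHybridUnder`; census `meanHybrid_chain` (11 conjuncts) and the
   inhabited-vacuous witness `exists_isPrintedAveraged_meanHybrid_vacuous`.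
NOT CLAIMED: NE7-V ⇒ NE7-S / NE7-SGB / NE7-SGB₀ / NE7-SGM / NE7-H (one-way producers only; no converse is known at the shape level); an
interface-level (`∃` factorisation) NE7-M shape; any relation of any shape to a printed statement; that any shape holds for Bałaban's scheme.
(v1.1) NE7-HM ⇒ NE7-V / NE7-M / NE7-S / NE7-H (the mean hybrid is the TV rung; no such converse); NE7-A′ / NE7-D / the density chain / NE7-TV
WITHOUT the tilt relation ⇒ NE7-HM (those shapes present run `K+1`'s law by a density that may vanish, not as a Gibbs tilt; not typed); an
interface-level NE7-HM shape; a run-B / two-sided version of §4.4's displays.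

DIVERGENCES (`DIVERGENCE.md` D-t4l.28; v1.1: D-t4l.29).  No new schematic choice: the measure-on-connections vocabulary, the observable algebra and
the finite-ε expectations are `T4Continuum` v5's (D-t4l.1–12); the prefix is `FiniteEpsData.UnderHypotheses` (D-t4l.14).  D-t4l.28 records only
that the clause lemma behind §1 is upstream's (`T4PathVarianceWeightSplit`, t4-ne7-p2; asked in journal NOTE l.59216) and enters BY NAME.
D-t4l.29 (v1.1) records the ONE added import `…T4PathMeanHybrid` (cone growth = that module alone), that §4's shapes put the CLAUSE FIRST like
every `…Under` shape of the family (upstream's `exists_effMeanHybrid_summable_iff` lists shape-then-clause; the `↔` of §4.3 reorders), that the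
TV-with-tilt form is named (`CanonicalEffTVRateTiltUnder`) rather than displayed, and that §4 follows the module owner's consumer probe.

Versions: v1 (unit `b2b-balaban-t4-lean` gen 22; p193126): §1–§3, 1 def + 21 theorems.  v1.1 (this file; gen 23): + §4 (3 defs + 29 theorems),
+ 1 import; every v1 declaration byte-identical.  Upstream at typing time (sha256[:16]): `T4ApexCanonical` v1.4 p192241 324a2e570d842f69,
`T4PathMeanHybrid` v1.1 p193361 8dee3a694583e17a, `T4PathVarianceRate` v1.5 p191671 df3c67478de84b31, `T4PathVarianceWeightSplit` v1.5 p193011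
f49422a2e20f1c75, `T4CanonicalTiltRate` d1053bf65b5fd3bd, `T4ApexVariance` v1.4 c51db7ee8d60f204, `T4Continuum` v5 7807998a5495afbd.
Downstream: none inside `Balaban1983to89/` (the root `Literature.lean` imports the leaf).
-/

open MeasureTheory Filter Topology

namespace Literature.MathematicalPhysics.QuantumFieldTheory.Balaban1983to89

open Missing T4Continuum T4VarianceMatching T4RunLadder T4CanonicalTiltRate T4ApexVariance T4ContinuumLaw T4ApexCanonical
open T4PathVarianceRate (mRate CanonicalEffPathVarianceRate CanonicalEffTiltMoment EffTermHybrid CanonicalEffTermHybrid fieldHybridRate)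

namespace T4ApexCanonical2

universe u

/-! ## §1 NE7-M ⇔ NE7-V under the targets' prefix, clauses included; the split form; the one-step names NE7-SGB / NE7-SGB₀ ⇒ NE7-M -/

section MomentVariance

variable {F : T4Family} {G : Type u} [GaugeGroup G] [MeasurableSpace G] [RegularGaugeGroup G] [HaarData G]

/-- **Canonical NE7-V ⇒ canonical NE7-M, CLAUSE INCLUDED**: witnesses `M = v²`, `M′ = 2v²(1+v²)`
(`T4PathVarianceRate.canonicalEffTiltMoment_of_canonicalEffPathVarianceRate`), clause by `T4PathVarianceWeightSplit.summable_mRate_sq_of_summable`.  The converse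
v1.4 §9.4 could not state. [folklore] -/
theorem canonicalTiltMomentUnder_of_canonicalPathVarianceUnder (D : FiniteEpsData F G) (hM : D.AvgMeasurable) {Hβ : Prop}
    (h : CanonicalPathVarianceUnder D hM Hβ) : CanonicalTiltMomentUnder D hM Hβ :=
  FiniteEpsData.UnderHypotheses.mono (fun g₀ hg => by
    obtain ⟨v, hv, hV⟩ := hg
    exact ⟨_, _, T4PathVarianceWeightSplit.summable_mRate_sq_of_summable hv,
      T4PathVarianceRate.canonicalEffTiltMoment_of_canonicalEffPathVarianceRate D hM g₀ hV⟩) h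

/-- **NE7-M ⇔ NE7-V UNDER THE PREFIX** (clauses included): `CanonicalTiltMomentUnder D hM Hβ ↔ CanonicalPathVarianceUnder D hM Hβ`
(⇒ = v1.4's `canonicalPathVarianceUnder_of_canonicalTiltMomentUnder`, rate `mRate M M′`; ⇐ above). [folklore] -/
theorem canonicalTiltMomentUnder_iff_canonicalPathVarianceUnder (D : FiniteEpsData F G) (hM : D.AvgMeasurable) (Hβ : Prop) :
    CanonicalTiltMomentUnder D hM Hβ ↔ CanonicalPathVarianceUnder D hM Hβ :=
  ⟨canonicalPathVarianceUnder_of_canonicalTiltMomentUnder D hM, canonicalTiltMomentUnder_of_canonicalPathVarianceUnder D hM⟩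

/-- **SPLIT NE7-M ⇔ NE7-V UNDER THE PREFIX**: `CanonicalTiltMomentSplitUnder D hM Hβ ↔ CanonicalPathVarianceUnder D hM Hβ` (through v1.3's
`canonicalTiltMomentSplitUnder_iff`). [folklore] -/
theorem canonicalTiltMomentSplitUnder_iff_canonicalPathVarianceUnder (D : FiniteEpsData F G) (hM : D.AvgMeasurable) (Hβ : Prop) :
    CanonicalTiltMomentSplitUnder D hM Hβ ↔ CanonicalPathVarianceUnder D hM Hβ :=
  (canonicalTiltMomentSplitUnder_iff D hM Hβ).trans (canonicalTiltMomentUnder_iff_canonicalPathVarianceUnder D hM Hβ)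

/-- **Canonical NE7-SGB ⇒ canonical NE7-M** (through NE7-V: v1.1's `canonicalPathVarianceUnder_of_canonicalTiltSandwichGBUnder`, then §1). [folklore] -/
theorem canonicalTiltMomentUnder_of_canonicalTiltSandwichGBUnder (D : FiniteEpsData F G) (hM : D.AvgMeasurable) {Hβ : Prop}
    (h : CanonicalTiltSandwichGBUnder D hM Hβ) : CanonicalTiltMomentUnder D hM Hβ :=
  canonicalTiltMomentUnder_of_canonicalPathVarianceUnder D hM (canonicalPathVarianceUnder_of_canonicalTiltSandwichGBUnder D hM h)

/-- **Canonical NE7-SGB₀ (v1.1 §7's four-input wall) ⇒ canonical NE7-M** (through NE7-V: `canonicalPathVarianceUnder_of_canonicalTiltSandwichGB₀Under`,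
then §1; v1.3 §9.4 reached NE7-M from NE7-SGB₀ through NE7-SGM with other witnesses — both hold). [folklore] -/
theorem canonicalTiltMomentUnder_of_canonicalTiltSandwichGB₀Under (D : FiniteEpsData F G) (hM : D.AvgMeasurable) {Hβ : Prop}
    (h : CanonicalTiltSandwichGB₀Under D hM Hβ) : CanonicalTiltMomentUnder D hM Hβ :=
  canonicalTiltMomentUnder_of_canonicalPathVarianceUnder D hM (canonicalPathVarianceUnder_of_canonicalTiltSandwichGB₀Under D hM h)

end MomentVariance

/-! ## §2 The rate-clothed field-level hybrid NE7-H under the prefix: `CanonicalTermHybridRateUnder ↔ CanonicalTermHybridUnder ↔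
CanonicalTiltSandwichUnder`; consequences by name, the limiting law WITH THE CLAUSE CARRIED -/

section TermHybridRate

variable {F : T4Family} {G : Type u} [GaugeGroup G] [MeasurableSpace G] [RegularGaugeGroup G] [HaarData G]

/-- HYPOTHESIS SHAPE — **CANONICAL NE7-H UNDER THE PREFIX, RATE-CLOTHED**: along every tuned Wilson scheme of the data, the field-level two-class
hybrid of consecutive canonical effective laws (`T4PathVarianceRate.CanonicalEffTermHybrid D hM g₀ r W`) with SUMMABLE PRODUCED NE7-S RATE
`fieldHybridRate r W K = r_K − log(1 − W_K)`.  EQUIVALENT to v1.4 §10.2's `CanonicalTermHybridUnder` (clause `Σ r_K < ∞ ∧ Σ W_K < ∞`;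
`canonicalTermHybridRateUnder_iff`).  NOT PRINTED for Bałaban's scheme; a definition, never asserted. [folklore] -/
def CanonicalTermHybridRateUnder (D : FiniteEpsData F G) (hM : D.AvgMeasurable) (Hβ : Prop) : Prop :=
  D.UnderHypotheses Hβ fun g₀ => ∃ r W : ℕ → ℝ, Summable (fieldHybridRate r W) ∧ CanonicalEffTermHybrid D hM g₀ r W

/-- Monotonicity in the β-side hypothesis. [folklore] -/
theorem CanonicalTermHybridRateUnder.of_imp {D : FiniteEpsData F G} {hM : D.AvgMeasurable} {H₁ H₂ : Prop} (himp : H₂ → H₁)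
    (h : CanonicalTermHybridRateUnder D hM H₁) : CanonicalTermHybridRateUnder D hM H₂ :=
  FiniteEpsData.UnderHypotheses.of_imp himp h

/-- PRIMED ⇒ UNPRIMED. [folklore] -/
theorem CanonicalTermHybridRateUnder.of_endpoint {D : FiniteEpsData F G} {hM : D.AvgMeasurable}
    (h : CanonicalTermHybridRateUnder D hM (DagBinding.EndpointExistence D.C.toB12)) :
    CanonicalTermHybridRateUnder D hM (BetaPertHyp D.βfun) :=
  FiniteEpsData.UnderHypotheses.of_endpoint h

/-- Vacuity at a datum violating the printed per-step form of (B). [folklore] -/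
theorem termHybridRate_of_not_endStatementBPrinted (D : FiniteEpsData F G) (hM : D.AvgMeasurable) (hB : ¬ B16.EndStatementBPrinted D.C)
    (Hβ : Prop) : CanonicalTermHybridRateUnder D hM Hβ :=
  fun h => absurd h hB

/-- **RATE-CLOTHED ⇔ SPLIT-CLOTHED NE7-H UNDER THE PREFIX**: `CanonicalTermHybridRateUnder D hM Hβ ↔ CanonicalTermHybridUnder D hM Hβ` — the same
witnesses `r W`, the clause rewritten by `T4PathVarianceWeightSplit.exists_effTermHybrid_summable_iff` at `unitFactorisation D hM g₀` (under the
shape `Summable (fieldHybridRate r W) ↔ Summable r ∧ Summable W`, at the signs `0 ≤ r_K`, `0 ≤ W_K < 1` the shape carries). [folklore] -/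
theorem canonicalTermHybridRateUnder_iff (D : FiniteEpsData F G) (hM : D.AvgMeasurable) (Hβ : Prop) :
    CanonicalTermHybridRateUnder D hM Hβ ↔ CanonicalTermHybridUnder D hM Hβ :=
  ⟨FiniteEpsData.UnderHypotheses.mono fun g₀ hg =>
      (T4PathVarianceWeightSplit.exists_effTermHybrid_summable_iff (unitFactorisation D hM g₀)).1 hg,
    FiniteEpsData.UnderHypotheses.mono fun g₀ hg =>
      (T4PathVarianceWeightSplit.exists_effTermHybrid_summable_iff (unitFactorisation D hM g₀)).2 hg⟩

/-- **RATE-CLOTHED NE7-H ⇔ NE7-S UNDER THE PREFIX** (through v1.4's `canonicalTermHybridUnder_iff`). [folklore] -/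
theorem canonicalTermHybridRateUnder_iff_canonicalTiltSandwichUnder (D : FiniteEpsData F G) (hM : D.AvgMeasurable) (Hβ : Prop) :
    CanonicalTermHybridRateUnder D hM Hβ ↔ CanonicalTiltSandwichUnder D hM Hβ :=
  (canonicalTermHybridRateUnder_iff D hM Hβ).trans (canonicalTermHybridUnder_iff D hM Hβ)

/-- Rate-clothed NE7-H ⇒ canonical NE7-V. [folklore] -/
theorem canonicalPathVarianceUnder_of_canonicalTermHybridRateUnder (D : FiniteEpsData F G) (hM : D.AvgMeasurable) {Hβ : Prop}
    (h : CanonicalTermHybridRateUnder D hM Hβ) : CanonicalPathVarianceUnder D hM Hβ :=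
  canonicalPathVarianceUnder_of_canonicalTermHybridUnder D hM ((canonicalTermHybridRateUnder_iff D hM Hβ).1 h)

/-- Rate-clothed NE7-H ⇒ canonical NE7-M. [folklore] -/
theorem canonicalTiltMomentUnder_of_canonicalTermHybridRateUnder (D : FiniteEpsData F G) (hM : D.AvgMeasurable) {Hβ : Prop}
    (h : CanonicalTermHybridRateUnder D hM Hβ) : CanonicalTiltMomentUnder D hM Hβ :=
  canonicalTiltMomentUnder_of_canonicalTermHybridUnder D hM ((canonicalTermHybridRateUnder_iff D hM Hβ).1 h)

/-- **Canonical NE7-H (split clause) ⇒ under the prefix the LIMITING LAW with modulus `B·Σ_{j≥K} fieldHybridRate r W j`, THE CLAUSE CARRIED**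
in the output existential (the primed sibling of v1.4 §10.2's `underHypotheses_limitLaw_of_canonicalTermHybridUnder`, which displays the shape but
not its clause; statement otherwise identical; `T4PathVarianceRate.exists_limitLaw_of_canonicalEffTermHybrid`). [folklore] -/
theorem underHypotheses_limitLaw_of_canonicalTermHybridUnder' (D : FiniteEpsData F G) (hM : D.AvgMeasurable) {Hβ : Prop}
    (h : CanonicalTermHybridUnder D hM Hβ) :
    D.UnderHypotheses Hβ fun g₀ => ∃ r W : ℕ → ℝ, (Summable r ∧ Summable W) ∧ CanonicalEffTermHybrid D hM g₀ r W ∧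
      ∃ ν : Measure (GaugeField (F.P 0) 0 G), IsProbabilityMeasure ν ∧ ν ≪ (unitFactorisation D hM g₀).effLaw 0 ∧
        ∀ (K : ℕ) (B : ℝ) (g : GaugeField (F.P 0) 0 G → ℝ), Measurable g → (∀ u, |g u| ≤ B) →
          |∫ u, g u ∂((unitFactorisation D hM g₀).effLaw K) - ∫ u, g u ∂ν| ≤ B * ∑' j, fieldHybridRate r W (j + K) :=
  FiniteEpsData.UnderHypotheses.mono (fun g₀ hg => by
    obtain ⟨r, W, hs, hS⟩ := hg
    exact ⟨r, W, hs, hS, T4PathVarianceRate.exists_limitLaw_of_canonicalEffTermHybrid D hM g₀ hS hs.1 hs.2⟩) h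

/-- **Rate-clothed canonical NE7-H ⇒ under the prefix the LIMITING LAW, THE RATE CLAUSE CARRIED** (`Summable (fieldHybridRate r W)` displayed;
through `canonicalTermHybridRateUnder_iff` and the primed export above). [folklore] -/
theorem underHypotheses_limitLaw_of_canonicalTermHybridRateUnder (D : FiniteEpsData F G) (hM : D.AvgMeasurable) {Hβ : Prop}
    (h : CanonicalTermHybridRateUnder D hM Hβ) :
    D.UnderHypotheses Hβ fun g₀ => ∃ r W : ℕ → ℝ, Summable (fieldHybridRate r W) ∧ CanonicalEffTermHybrid D hM g₀ r W ∧
      ∃ ν : Measure (GaugeField (F.P 0) 0 G), IsProbabilityMeasure ν ∧ ν ≪ (unitFactorisation D hM g₀).effLaw 0 ∧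
        ∀ (K : ℕ) (B : ℝ) (g : GaugeField (F.P 0) 0 G → ℝ), Measurable g → (∀ u, |g u| ≤ B) →
          |∫ u, g u ∂((unitFactorisation D hM g₀).effLaw K) - ∫ u, g u ∂ν| ≤ B * ∑' j, fieldHybridRate r W (j + K) :=
  FiniteEpsData.UnderHypotheses.mono (fun g₀ hg => by
    obtain ⟨r, W, hs, hS⟩ := hg
    have hs' := (T4PathVarianceWeightSplit.summable_fieldHybridRate_iff_of_effTermHybrid hS).1 hs
    exact ⟨r, W, hs, hS, T4PathVarianceRate.exists_limitLaw_of_canonicalEffTermHybrid D hM g₀ hS hs'.1 hs'.2⟩) h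

/-- **Rate-clothed canonical NE7-H under the scoping note's β-hypothesis ⇒ THE EXISTENCE TARGET.** [folklore] -/
theorem limit_exists_of_canonicalTermHybridRateUnder (D : FiniteEpsData F G) (hM : D.AvgMeasurable)
    (h : CanonicalTermHybridRateUnder D hM (BetaPertHyp D.βfun)) : D.ym4_torus_continuum_limit_exists :=
  limit_exists_of_canonicalTermHybridUnder D hM ((canonicalTermHybridRateUnder_iff D hM _).1 h)

/-- Print-faithful form. [folklore] -/
theorem limit_exists'_of_canonicalTermHybridRateUnder' (D : FiniteEpsData F G) (hM : D.AvgMeasurable)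
    (h : CanonicalTermHybridRateUnder D hM (DagBinding.EndpointExistence D.C.toB12)) : D.ym4_torus_continuum_limit_exists' :=
  limit_exists'_of_canonicalTermHybridUnder' D hM ((canonicalTermHybridRateUnder_iff D hM _).1 h)

end TermHybridRate

section TermHybridRateSU

variable {F : T4Family} {N : ℕ} [NeZero N] {D : FiniteEpsData F (Matrix.specialUnitaryGroup (Fin N) ℂ)}

/-- **PRINTED-AVERAGED DATA on `SU(N)`: rate-clothed canonical NE7-H under the prefix ⇒ ALL FOUR TARGETS** (scoping note's form). [folklore] -/
theorem printed_targets_of_canonicalTermHybridRateUnder (h : D.IsPrintedAveraged)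
    (hR : CanonicalTermHybridRateUnder D h.avgMeasurable (BetaPertHyp D.βfun)) :
    D.ym4_torus_continuum_limit_exists ∧ D.ym4_torus_continuum_limit_unique ∧
      D.limit_reflectionPositive ∧ D.limit_torusCovariant :=
  printed_targets_of_canonicalTermHybridUnder h ((canonicalTermHybridRateUnder_iff D _ _).1 hR)

/-- Print-faithful form. [folklore] -/
theorem printed_targets'_of_canonicalTermHybridRateUnder' (h : D.IsPrintedAveraged)
    (hR : CanonicalTermHybridRateUnder D h.avgMeasurable (DagBinding.EndpointExistence D.C.toB12)) :
    D.ym4_torus_continuum_limit_exists' ∧ D.ym4_torus_continuum_limit_unique' ∧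
      D.limit_reflectionPositive' ∧ D.limit_torusCovariant' :=
  printed_targets'_of_canonicalTermHybridUnder' h ((canonicalTermHybridRateUnder_iff D _ _).1 hR)

end TermHybridRateSU

section TermHybridRateHeadline

variable {N : ℕ} [NeZero N]

/-- **`T4Apex.YM4TorusContinuumPrintedSU N` FROM RATE-CLOTHED CANONICAL NE7-H FOR ALL PRINTED-AVERAGED DATA** — CONDITIONAL on the carved
two-class hybrid input read at field level with `Σ_K (r_K − log(1 − W_K)) < ∞`; the antecedent is NOT PRINTED for Bałaban's scheme. [folklore] -/
theorem printedSU_of_canonicalTermHybridRateUnder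
    (h : ∀ (F : T4Family) (D : FiniteEpsData F (Matrix.specialUnitaryGroup (Fin N) ℂ)) (hP : D.IsPrintedAveraged),
      CanonicalTermHybridRateUnder D hP.avgMeasurable (BetaPertHyp D.βfun)) :
    T4Apex.YM4TorusContinuumPrintedSU N :=
  printedSU_of_canonicalTermHybridUnder fun F D hP => (canonicalTermHybridRateUnder_iff D _ _).1 (h F D hP)

end TermHybridRateHeadline

/-! ## §3 Census conjunction of this leaf and the inhabited-vacuous witness -/

section Census

variable {F : T4Family} {G : Type u} [GaugeGroup G] [MeasurableSpace G] [RegularGaugeGroup G] [HaarData G]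

/-- **CENSUS BY NAME — THE LEAF'S FORMS** (any `Hβ`): NE7-M ⇔ NE7-V; split NE7-M ⇔ NE7-V; NE7-SGB ⇒ NE7-M; NE7-SGB₀ ⇒ NE7-M; rate-clothed NE7-H ⇔
NE7-H ⇔ NE7-S; rate-clothed NE7-H ⇒ NE7-V, NE7-M.  No other converse claimed; antecedents NOT PRINTED. [folklore] -/
theorem momentVariance_chain (D : FiniteEpsData F G) (hM : D.AvgMeasurable) (Hβ : Prop) :
    (CanonicalTiltMomentUnder D hM Hβ ↔ CanonicalPathVarianceUnder D hM Hβ) ∧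
      (CanonicalTiltMomentSplitUnder D hM Hβ ↔ CanonicalPathVarianceUnder D hM Hβ) ∧
      (CanonicalTiltSandwichGBUnder D hM Hβ → CanonicalTiltMomentUnder D hM Hβ) ∧
      (CanonicalTiltSandwichGB₀Under D hM Hβ → CanonicalTiltMomentUnder D hM Hβ) ∧
      (CanonicalTermHybridRateUnder D hM Hβ ↔ CanonicalTermHybridUnder D hM Hβ) ∧
      (CanonicalTermHybridRateUnder D hM Hβ ↔ CanonicalTiltSandwichUnder D hM Hβ) ∧
      (CanonicalTermHybridRateUnder D hM Hβ → CanonicalPathVarianceUnder D hM Hβ) ∧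
      (CanonicalTermHybridRateUnder D hM Hβ → CanonicalTiltMomentUnder D hM Hβ) :=
  ⟨canonicalTiltMomentUnder_iff_canonicalPathVarianceUnder D hM Hβ, canonicalTiltMomentSplitUnder_iff_canonicalPathVarianceUnder D hM Hβ,
    canonicalTiltMomentUnder_of_canonicalTiltSandwichGBUnder D hM, canonicalTiltMomentUnder_of_canonicalTiltSandwichGB₀Under D hM,
    canonicalTermHybridRateUnder_iff D hM Hβ, canonicalTermHybridRateUnder_iff_canonicalTiltSandwichUnder D hM Hβ,
    canonicalPathVarianceUnder_of_canonicalTermHybridRateUnder D hM, canonicalTiltMomentUnder_of_canonicalTermHybridRateUnder D hM⟩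

end Census

/-- The printed one-level class on `SU(N)` contains, for every `N ≥ 1` and every lattice family, a datum violating (B) at which the rate-clothed
shape of §2 — and, by §1, NE7-M together with NE7-V — hold for every `Hβ` and every measurability witness: inhabited and vacuous, by name
(`T4Apex.exists_isPrintedAveraged₁_not_endStatementBPrinted`). [folklore] -/
theorem exists_isPrintedAveraged_termHybridRate_vacuous {N : ℕ} [NeZero N] (F : T4Family) (Hβ : Prop) :
    ∃ D : FiniteEpsData F (Matrix.specialUnitaryGroup (Fin N) ℂ), D.IsPrintedAveraged ∧ ¬ B16.EndStatementBPrinted D.C ∧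
      ∀ hM : D.AvgMeasurable, CanonicalTermHybridRateUnder D hM Hβ ∧ CanonicalTiltMomentUnder D hM Hβ ∧
        CanonicalPathVarianceUnder D hM Hβ := by
  obtain ⟨D, h₁, hB⟩ := T4Apex.exists_isPrintedAveraged₁_not_endStatementBPrinted (N := N) F
  refine ⟨D, h₁.isPrintedAveraged, hB, fun hM => ⟨termHybridRate_of_not_endStatementBPrinted D hM hB Hβ, ?_, ?_⟩⟩
  · exact canonicalTiltMomentUnder_of_canonicalTermHybridRateUnder D hM (termHybridRate_of_not_endStatementBPrinted D hM hB Hβ)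
  · exact canonicalPathVarianceUnder_of_canonicalTermHybridRateUnder D hM (termHybridRate_of_not_endStatementBPrinted D hM hB Hβ)

/-! ## §4 (v1.1) The hybrid IN THE MEAN NE7-HM under the targets' prefix — by name from `T4PathMeanHybrid` (t4-ne7-p3 gen 10; v1 p193082 ⊆ v1.1
p193361 by name and signature; only v1's declarations are consumed): the shapes, the
order NE7-S / NE7-H / NE7-V / NE7-M / NE7-A ⇒ NE7-HM ⇒ NE7-TV, the kernel `↔` NE7-HM ⇔ NE7-TV ∧ tilt (NO HIDDEN STRENGTH), node U5's output and the
limiting law WITH THE CLAUSE CARRIED, the targets, the headline, the census (consumer bindings after the module owner's kernel-checked probe) -/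

open T4PathMeanHybrid (meanHybridRate EffMeanHybrid CanonicalEffMeanHybrid EffTermMeanHybrid summable_meanHybridRate)

/-! ### §4.1 The shapes under the prefix (clause first, as every `…Under` shape of the family) -/

section MeanHybridShapes

variable {F : T4Family} {G : Type u} [GaugeGroup G] [MeasurableSpace G] [RegularGaugeGroup G] [HaarData G]

/-- HYPOTHESIS SHAPE — **CANONICAL NE7-HM UNDER THE PREFIX**: along every tuned Wilson scheme of the data, the field-level hybrid IN THE MEAN of
consecutive canonical effective laws (`T4PathMeanHybrid.CanonicalEffMeanHybrid D hM g₀ r W W'`: run `K+1`'s law is the Gibbs tilt of run `K`'s by a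
measurable `f_K`, the two-run sandwich `e^{c−r} ≤ e^{f} ≤ e^{c+r}` holds DEFECTIVELY with measurable defects `0 ≤ β_K, β'_K ≤ 1` whose MEANS under the
runs' OWN laws are `≤ W_K`, `≤ W'_K`) with the clause `Σ r_K < ∞ ∧ Σ W_K < ∞ ∧ Σ W'_K < ∞`.  By §4.3 EXACTLY canonical NE7-TV under the prefix together
with the tilt relation.  NOT PRINTED for Bałaban's scheme ([Balaban1989LargeFieldII] p. 356 defers expectation values; GAPS G-ne7p3-7); a definition,
never asserted. [folklore] -/
def CanonicalMeanHybridUnder (D : FiniteEpsData F G) (hM : D.AvgMeasurable) (Hβ : Prop) : Prop :=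
  D.UnderHypotheses Hβ fun g₀ => ∃ r W W' : ℕ → ℝ, (Summable r ∧ Summable W ∧ Summable W') ∧ CanonicalEffMeanHybrid D hM g₀ r W W'

/-- Monotonicity in the β-side hypothesis. [folklore] -/
theorem CanonicalMeanHybridUnder.of_imp {D : FiniteEpsData F G} {hM : D.AvgMeasurable} {H₁ H₂ : Prop} (himp : H₂ → H₁)
    (h : CanonicalMeanHybridUnder D hM H₁) : CanonicalMeanHybridUnder D hM H₂ :=
  FiniteEpsData.UnderHypotheses.of_imp himp h

/-- PRIMED ⇒ UNPRIMED. [folklore] -/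
theorem CanonicalMeanHybridUnder.of_endpoint {D : FiniteEpsData F G} {hM : D.AvgMeasurable}
    (h : CanonicalMeanHybridUnder D hM (DagBinding.EndpointExistence D.C.toB12)) :
    CanonicalMeanHybridUnder D hM (BetaPertHyp D.βfun) :=
  FiniteEpsData.UnderHypotheses.of_endpoint h

/-- Vacuity at a datum violating the printed per-step form of (B). [folklore] -/
theorem meanHybrid_of_not_endStatementBPrinted (D : FiniteEpsData F G) (hM : D.AvgMeasurable) (hB : ¬ B16.EndStatementBPrinted D.C)
    (Hβ : Prop) : CanonicalMeanHybridUnder D hM Hβ :=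
  fun h => absurd h hB

/-- HYPOTHESIS SHAPE — **THE TERM-WISE SOCKET NE7-HMT UNDER THE PREFIX** (`T4PathMeanHybrid.EffTermMeanHybrid` along the canonical unit
factorisation: the good class of term densities sandwiched POINTWISE on two measurable single-run cores, the bad class and the core complements charged
IN THE MEAN to each run's own law; same clause).  A producer's input: it implies `CanonicalMeanHybridUnder` at the SAME rates (§4.2).  NOT PRINTED;
never asserted. [folklore] -/
def CanonicalTermMeanHybridUnder (D : FiniteEpsData F G) (hM : D.AvgMeasurable) (Hβ : Prop) : Prop :=
  D.UnderHypotheses Hβ fun g₀ => ∃ r W W' : ℕ → ℝ, (Summable r ∧ Summable W ∧ Summable W') ∧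
    EffTermMeanHybrid (unitFactorisation D hM g₀) r W W'

/-- HYPOTHESIS SHAPE — **CANONICAL NE7-TV TOGETHER WITH THE TILT RELATION, UNDER THE PREFIX**: v1.x's `T4ApexCanonical.CanonicalEffTVRateUnder`
(a summable one-sided set-wise total-variation rate of consecutive canonical effective laws) AND, for every `K`, run `K+1`'s canonical law is the
Gibbs tilt of run `K`'s by SOME measurable relative action.  §4.3: this IS `CanonicalMeanHybridUnder` (kernel `↔`).  NOT PRINTED; never asserted.
[folklore] -/
def CanonicalEffTVRateTiltUnder (D : FiniteEpsData F G) (hM : D.AvgMeasurable) (Hβ : Prop) : Prop :=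
  D.UnderHypotheses Hβ fun g₀ => (∃ t : ℕ → ℝ, Summable t ∧ T4MaximalCoupling.EffTVRate (unitFactorisation D hM g₀) t) ∧
    ∀ K, ∃ f : GaugeField (F.P 0) 0 G → ℝ, Measurable f ∧
      (unitFactorisation D hM g₀).effLaw (K + 1) = ((unitFactorisation D hM g₀).effLaw K).tilted f

end MeanHybridShapes

/-! ### §4.2 The order INTO the mean hybrid: the socket, NE7-S, NE7-H (split- and rate-clothed), NE7-V, NE7-M, NE7-A ⇒ NE7-HM -/

section MeanHybridOrder

variable {F : T4Family} {G : Type u} [GaugeGroup G] [MeasurableSpace G] [RegularGaugeGroup G] [HaarData G]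

/-- **The term-wise socket under the prefix ⇒ NE7-HM under the prefix, SAME rates** (`T4PathMeanHybrid.effMeanHybrid_of_effTermMeanHybrid` at
`scheme_β_nonneg`). [folklore] -/
theorem canonicalMeanHybridUnder_of_canonicalTermMeanHybridUnder (D : FiniteEpsData F G) (hM : D.AvgMeasurable) {Hβ : Prop}
    (h : CanonicalTermMeanHybridUnder D hM Hβ) : CanonicalMeanHybridUnder D hM Hβ :=
  FiniteEpsData.UnderHypotheses.mono (fun g₀ hg => by
    obtain ⟨r, W, W', hs, hS⟩ := hg
    exact ⟨r, W, W', hs, T4PathMeanHybrid.effMeanHybrid_of_effTermMeanHybrid _ (scheme_β_nonneg D g₀) hS⟩) h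

/-- **Canonical NE7-S ⇒ canonical NE7-HM with NO defects** (`W = W' = 0`; `T4PathMeanHybrid.effMeanHybrid_of_effTiltSandwich`). [folklore] -/
theorem canonicalMeanHybridUnder_of_canonicalTiltSandwichUnder (D : FiniteEpsData F G) (hM : D.AvgMeasurable) {Hβ : Prop}
    (h : CanonicalTiltSandwichUnder D hM Hβ) : CanonicalMeanHybridUnder D hM Hβ :=
  FiniteEpsData.UnderHypotheses.mono (fun g₀ hg => by
    obtain ⟨r, hs, hS⟩ := hg
    exact ⟨r, 0, 0, ⟨hs, summable_zero, summable_zero⟩,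
      T4PathMeanHybrid.effMeanHybrid_of_effTiltSandwich (unitFactorisation D hM g₀) hS⟩) h

/-- **Canonical NE7-H (split clause, v1.4 §10.2) ⇒ canonical NE7-HM** with rate `fieldHybridRate r W = r − log(1 − W)` and no defects
(`T4PathMeanHybrid.canonicalEffMeanHybrid_of_canonicalEffTermHybrid`; clause by `T4PathVarianceWeightSplit.summable_fieldHybridRate_iff_of_effTermHybrid`).
[folklore] -/
theorem canonicalMeanHybridUnder_of_canonicalTermHybridUnder (D : FiniteEpsData F G) (hM : D.AvgMeasurable) {Hβ : Prop}
    (h : CanonicalTermHybridUnder D hM Hβ) : CanonicalMeanHybridUnder D hM Hβ :=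
  FiniteEpsData.UnderHypotheses.mono (fun g₀ hg => by
    obtain ⟨r, W, hs, hS⟩ := hg
    have hs' := (T4PathVarianceWeightSplit.summable_fieldHybridRate_iff_of_effTermHybrid hS).2 hs
    exact ⟨fieldHybridRate r W, 0, 0, ⟨hs', summable_zero, summable_zero⟩,
      T4PathMeanHybrid.canonicalEffMeanHybrid_of_canonicalEffTermHybrid D hM g₀ hS⟩) h

/-- **Rate-clothed canonical NE7-H (§2) ⇒ canonical NE7-HM**, the rate clause `Summable (fieldHybridRate r W)` carried verbatim. [folklore] -/
theorem canonicalMeanHybridUnder_of_canonicalTermHybridRateUnder (D : FiniteEpsData F G) (hM : D.AvgMeasurable) {Hβ : Prop}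
    (h : CanonicalTermHybridRateUnder D hM Hβ) : CanonicalMeanHybridUnder D hM Hβ :=
  FiniteEpsData.UnderHypotheses.mono (fun g₀ hg => by
    obtain ⟨r, W, hs, hS⟩ := hg
    exact ⟨fieldHybridRate r W, 0, 0, ⟨hs, summable_zero, summable_zero⟩,
      T4PathMeanHybrid.canonicalEffMeanHybrid_of_canonicalEffTermHybrid D hM g₀ hS⟩) h

/-- **Canonical NE7-V ⇒ canonical NE7-HM with `(r, W, W') = (0, v, v)`**: NE7-V is canonical NE7-TV at the same rate
(`T4PathVarianceRate.effTVRate_of_effPathVarianceRate`) and its shape carries the tilt relation; then `T4PathMeanHybrid.effMeanHybrid_of_effTVRate`.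
Hence every secant-lane shape of the parent (NE7-SGB / SGB₀ / SGM / GM-moment / GM-root, split forms) reaches NE7-HM through NE7-V by the parent's names.
[folklore] -/
theorem canonicalMeanHybridUnder_of_canonicalPathVarianceUnder (D : FiniteEpsData F G) (hM : D.AvgMeasurable) {Hβ : Prop}
    (h : CanonicalPathVarianceUnder D hM Hβ) : CanonicalMeanHybridUnder D hM Hβ :=
  FiniteEpsData.UnderHypotheses.mono (fun g₀ hg => by
    obtain ⟨v, hv, hV⟩ := hg
    exact ⟨0, v, v, ⟨summable_zero, hv, hv⟩,
      T4PathMeanHybrid.effMeanHybrid_of_effTVRate (unitFactorisation D hM g₀) (scheme_β_nonneg D g₀)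
        (T4PathVarianceRate.effTVRate_of_effPathVarianceRate (unitFactorisation D hM g₀) (scheme_β_nonneg D g₀) hV)
        fun K => by
          obtain ⟨f, hf, -, -, heq, -⟩ := hV K
          exact ⟨f, hf, heq⟩⟩) h

/-- **Canonical NE7-M ⇒ canonical NE7-HM** (through NE7-V: v1.4's `canonicalPathVarianceUnder_of_canonicalTiltMomentUnder`, then the above). [folklore] -/
theorem canonicalMeanHybridUnder_of_canonicalTiltMomentUnder (D : FiniteEpsData F G) (hM : D.AvgMeasurable) {Hβ : Prop}
    (h : CanonicalTiltMomentUnder D hM Hβ) : CanonicalMeanHybridUnder D hM Hβ :=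
  canonicalMeanHybridUnder_of_canonicalPathVarianceUnder D hM (canonicalPathVarianceUnder_of_canonicalTiltMomentUnder D hM h)

/-- **Canonical NE7-A (the Gibbs-tilt lane) ⇒ canonical NE7-HM with `(r, W, W') = (0, δ, δ)`, `δ_K = 2e^{2R}σ_K`**: NE7-A is a canonical density
chain (`canonicalDensityChain_of_canonicalEffTiltRate`), hence canonical NE7-TV (`T4EffectiveLawLimit.effTVRate_of_densityChain`), and its shape
carries the tilt relation (`canonicalEffTiltRate_iff`); then `T4PathMeanHybrid.effMeanHybrid_of_effTVRate`. [folklore] -/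
theorem canonicalMeanHybridUnder_of_canonicalEffTiltRateUnder (D : FiniteEpsData F G) (hM : D.AvgMeasurable) {Hβ : Prop}
    (h : CanonicalEffTiltRateUnder D hM Hβ) : CanonicalMeanHybridUnder D hM Hβ :=
  FiniteEpsData.UnderHypotheses.mono (fun g₀ hg => by
    obtain ⟨R, σ, hσ, hT⟩ := hg
    have ht := T4EffectiveLawLimit.effTVRate_of_densityChain (unitFactorisation D hM g₀) (scheme_β_nonneg D g₀)
      (canonicalDensityChain_of_canonicalEffTiltRate D hM g₀ hT)
    exact ⟨0, fun K => 2 * Real.exp (2 * R) * σ K, fun K => 2 * Real.exp (2 * R) * σ K,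
      ⟨summable_zero, hσ.mul_left _, hσ.mul_left _⟩,
      T4PathMeanHybrid.effMeanHybrid_of_effTVRate (unitFactorisation D hM g₀) (scheme_β_nonneg D g₀) ht fun K => by
        obtain ⟨f, κ, hf, -, heq, -⟩ := (canonicalEffTiltRate_iff D hM g₀ R σ).1 hT K
        exact ⟨f, hf, heq⟩⟩) h

end MeanHybridOrder

/-! ### §4.3 NO HIDDEN STRENGTH under the prefix: NE7-HM ⇔ NE7-TV ∧ tilt; the order OUT OF the mean hybrid (NE7-TV, the limiting law of the data,
the interface TV shape, `MatchingUnder`, `GenFunCauchyUnder`, `StringwiseUnder`) -/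

section MeanHybridTV

variable {F : T4Family} {G : Type u} [GaugeGroup G] [MeasurableSpace G] [RegularGaugeGroup G] [HaarData G]

/-- **NE7-HM UNDER THE PREFIX ⇔ NE7-TV UNDER THE PREFIX ∧ THE TILT RELATION** — `CanonicalMeanHybridUnder D hM Hβ ↔ CanonicalEffTVRateTiltUnder D hM Hβ`:
⇒ at rate `meanHybridRate r W W' = 2r + W + W'` (`T4PathMeanHybrid.effTVRate_of_effMeanHybrid`), ⇐ with `(r, W, W') = (0, t, t)`
(`T4PathMeanHybrid.effMeanHybrid_of_effTVRate`); both through `T4PathMeanHybrid.exists_effMeanHybrid_summable_iff` at `scheme_β_nonneg`, the clause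
reordered.  At clause level the mean hybrid adds NO estimate to pv01's TV currency — only the two-class READING of a TV bound; under the prefix it sits
ON the TV rung, below NE7-V / NE7-M / NE7-S / NE7-H in what it asks (no converse to those is claimed). [folklore] -/
theorem canonicalMeanHybridUnder_iff_canonicalEffTVRateTiltUnder (D : FiniteEpsData F G) (hM : D.AvgMeasurable) (Hβ : Prop) :
    CanonicalMeanHybridUnder D hM Hβ ↔ CanonicalEffTVRateTiltUnder D hM Hβ := by
  constructor
  · exact FiniteEpsData.UnderHypotheses.mono fun g₀ hg => by
      obtain ⟨r, W, W', hs, hS⟩ := hg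
      obtain ⟨⟨t, ht, hts⟩, htilt⟩ :=
        (T4PathMeanHybrid.exists_effMeanHybrid_summable_iff (unitFactorisation D hM g₀) (scheme_β_nonneg D g₀)).1 ⟨r, W, W', hS, hs⟩
      exact ⟨⟨t, hts, ht⟩, htilt⟩
  · exact FiniteEpsData.UnderHypotheses.mono fun g₀ hg => by
      obtain ⟨⟨t, hts, ht⟩, htilt⟩ := hg
      obtain ⟨r, W, W', hS, hs⟩ :=
        (T4PathMeanHybrid.exists_effMeanHybrid_summable_iff (unitFactorisation D hM g₀) (scheme_β_nonneg D g₀)).2 ⟨⟨t, ht, hts⟩, htilt⟩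
      exact ⟨r, W, W', hs, hS⟩

/-- NE7-TV-with-tilt under the prefix ⇒ v1.x's canonical NE7-TV under the prefix (the tilt conjunct dropped). [folklore] -/
theorem canonicalEffTVRateUnder_of_canonicalEffTVRateTiltUnder (D : FiniteEpsData F G) (hM : D.AvgMeasurable) {Hβ : Prop}
    (h : CanonicalEffTVRateTiltUnder D hM Hβ) : CanonicalEffTVRateUnder D hM Hβ :=
  FiniteEpsData.UnderHypotheses.mono (fun _ hg => hg.1) h

/-- **Canonical NE7-HM ⇒ canonical NE7-TV under the prefix**, rate `meanHybridRate r W W' = 2r + W + W'`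
(`T4PathMeanHybrid.canonicalEffTVRate_of_canonicalEffMeanHybrid`, `.summable_meanHybridRate`). [folklore] -/
theorem canonicalEffTVRateUnder_of_canonicalMeanHybridUnder (D : FiniteEpsData F G) (hM : D.AvgMeasurable) {Hβ : Prop}
    (h : CanonicalMeanHybridUnder D hM Hβ) : CanonicalEffTVRateUnder D hM Hβ :=
  FiniteEpsData.UnderHypotheses.mono (fun g₀ hg => by
    obtain ⟨r, W, W', ⟨hr, hW, hW'⟩, hS⟩ := hg
    exact ⟨meanHybridRate r W W', summable_meanHybridRate hr hW hW',
      T4PathMeanHybrid.canonicalEffTVRate_of_canonicalEffMeanHybrid D hM g₀ hS⟩) h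

/-- **Canonical NE7-HM ⇒ the limiting effective unit-lattice law of the data under the prefix** (through NE7-TV: v1.x's
`canonicalLawLimitUnder_of_canonicalEffTVRateUnder`). [folklore] -/
theorem canonicalLawLimitUnder_of_canonicalMeanHybridUnder (D : FiniteEpsData F G) (hM : D.AvgMeasurable) {Hβ : Prop}
    (h : CanonicalMeanHybridUnder D hM Hβ) : CanonicalLawLimitUnder D hM Hβ :=
  canonicalLawLimitUnder_of_canonicalEffTVRateUnder D hM (canonicalEffTVRateUnder_of_canonicalMeanHybridUnder D hM h)

/-- Canonical NE7-HM ⇒ the interface shape `T4ApexVariance.EffTVRateUnder` (v1.x's `effTVRateUnder_of_canonical`). [folklore] -/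
theorem effTVRateUnder_of_canonicalMeanHybridUnder (D : FiniteEpsData F G) (hM : D.AvgMeasurable) {Hβ : Prop}
    (h : CanonicalMeanHybridUnder D hM Hβ) : EffTVRateUnder D Hβ :=
  effTVRateUnder_of_canonical D hM (canonicalEffTVRateUnder_of_canonicalMeanHybridUnder D hM h)

/-- **Canonical NE7-HM ⇒ `MatchingUnder`** (node U5's output in the form nodes U0–U4 consume; v1.x's `matchingUnder_of_canonicalEffTVRateUnder`).
[folklore] -/
theorem matchingUnder_of_canonicalMeanHybridUnder (D : FiniteEpsData F G) (hM : D.AvgMeasurable) {Hβ : Prop}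
    (h : CanonicalMeanHybridUnder D hM Hβ) : MatchingUnder D Hβ :=
  matchingUnder_of_canonicalEffTVRateUnder D hM (canonicalEffTVRateUnder_of_canonicalMeanHybridUnder D hM h)

/-- **Canonical NE7-HM ⇒ node U0's input `T4Assembly.GenFunCauchyUnder D Hβ`** DIRECTLY at radius `1`
(`T4PathMeanHybrid.genFunCauchy_of_canonicalEffMeanHybrid`). [folklore] -/
theorem genFunCauchyUnder_of_canonicalMeanHybridUnder (D : FiniteEpsData F G) (hM : D.AvgMeasurable) {Hβ : Prop}
    (h : CanonicalMeanHybridUnder D hM Hβ) : T4Assembly.GenFunCauchyUnder D Hβ :=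
  FiniteEpsData.UnderHypotheses.mono (fun g₀ hg => by
    obtain ⟨r, W, W', ⟨hr, hW, hW'⟩, hS⟩ := hg
    exact ⟨1, one_pos, T4PathMeanHybrid.genFunCauchy_of_canonicalEffMeanHybrid D hM g₀ hS hr hW hW' zero_le_one⟩) h

/-- Canonical NE7-HM ⇒ per-string Cauchy radii `T4ApexHybrid.StringwiseUnder` (through the limiting law; v1.x's
`stringwiseUnder_of_canonicalLawLimitUnder`). [folklore] -/
theorem stringwiseUnder_of_canonicalMeanHybridUnder (D : FiniteEpsData F G) (hM : D.AvgMeasurable) {Hβ : Prop}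
    (h : CanonicalMeanHybridUnder D hM Hβ) : T4ApexHybrid.StringwiseUnder D Hβ :=
  stringwiseUnder_of_canonicalLawLimitUnder D hM (canonicalLawLimitUnder_of_canonicalMeanHybridUnder D hM h)

end MeanHybridTV

/-! ### §4.4 Node U5's output and the limiting law under the prefix, the shape's own `r W W'` displayed, THE CLAUSE CARRIED -/

section MeanHybridDisplays

variable {F : T4Family} {G : Type u} [GaugeGroup G] [MeasurableSpace G] [RegularGaugeGroup G] [HaarData G]

/-- **NODE U5's OUTPUT AT EVERY RADIUS FROM THE MEAN HYBRID, UNDER THE PREFIX**: canonical NE7-HM ⇒ along every tuned scheme, with the shape's own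
`r W W'` and its clause, `T4CauchySum.MatchingModConstants 1 l₀ (K ↦ e^{2l₀}·2·(2r_K + W_K + W'_K)) (schemeZ (D.scheme g₀) Cs)` for every `l₀ ≥ 0` and
every string `Cs` (`T4PathMeanHybrid.matchingModConstants_of_canonicalEffMeanHybrid`, verbatim remainder). [folklore] -/
theorem underHypotheses_matchingModConstants_of_canonicalMeanHybridUnder (D : FiniteEpsData F G) (hM : D.AvgMeasurable) {Hβ : Prop}
    (h : CanonicalMeanHybridUnder D hM Hβ) :
    D.UnderHypotheses Hβ fun g₀ => ∃ r W W' : ℕ → ℝ, (Summable r ∧ Summable W ∧ Summable W') ∧ CanonicalEffMeanHybrid D hM g₀ r W W' ∧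
      ∀ (l₀ : ℝ), 0 ≤ l₀ → ∀ Cs : List (ULoop F),
        T4CauchySum.MatchingModConstants 1 l₀ (fun K => Real.exp (2 * l₀) * (2 * meanHybridRate r W W' K))
          (T4GenFunBounds.schemeZ (D.scheme g₀) Cs) :=
  FiniteEpsData.UnderHypotheses.mono (fun g₀ hg => by
    obtain ⟨r, W, W', hs, hS⟩ := hg
    exact ⟨r, W, W', hs, hS, fun l₀ hl₀ Cs => T4PathMeanHybrid.matchingModConstants_of_canonicalEffMeanHybrid D hM g₀ hS hl₀ Cs⟩) h

/-- **THE LIMITING LAW IN TOTAL VARIATION WITH THE MEAN-HYBRID TAIL, UNDER THE PREFIX, THE CLAUSE CARRIED**: canonical NE7-HM ⇒ along every tuned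
scheme, with the shape's own `r W W'`, a probability law `ν ≪ T4EffectiveLawLimit.domMeasure (effLaw)` with
`|∫ g d(effLaw K) − ∫ g dν| ≤ B · Σ_j 2·(2r_{j+K} + W_{j+K} + W'_{j+K})` for measurable `|g| ≤ B`
(`T4PathMeanHybrid.exists_limitLaw_of_canonicalEffMeanHybrid`, verbatim conclusion). [folklore] -/
theorem underHypotheses_limitLaw_of_canonicalMeanHybridUnder (D : FiniteEpsData F G) (hM : D.AvgMeasurable) {Hβ : Prop}
    (h : CanonicalMeanHybridUnder D hM Hβ) :
    D.UnderHypotheses Hβ fun g₀ => ∃ r W W' : ℕ → ℝ, (Summable r ∧ Summable W ∧ Summable W') ∧ CanonicalEffMeanHybrid D hM g₀ r W W' ∧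
      ∃ ν : Measure (GaugeField (F.P 0) 0 G), IsProbabilityMeasure ν ∧
        ν ≪ T4EffectiveLawLimit.domMeasure (unitFactorisation D hM g₀).effLaw ∧
        ∀ (K : ℕ) (B : ℝ) (g : GaugeField (F.P 0) 0 G → ℝ), Measurable g → (∀ u, |g u| ≤ B) →
          |∫ u, g u ∂((unitFactorisation D hM g₀).effLaw K) - ∫ u, g u ∂ν| ≤ B * ∑' j, 2 * meanHybridRate r W W' (j + K) :=
  FiniteEpsData.UnderHypotheses.mono (fun g₀ hg => by
    obtain ⟨r, W, W', ⟨hr, hW, hW'⟩, hS⟩ := hg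
    exact ⟨r, W, W', ⟨hr, hW, hW'⟩, hS, T4PathMeanHybrid.exists_limitLaw_of_canonicalEffMeanHybrid D hM g₀ hS hr hW hW'⟩) h

end MeanHybridDisplays

/-! ### §4.5 The targets from the mean hybrid: existence(′), the four targets on printed-averaged `SU(N)` / (0.4) data, the headline -/

section MeanHybridTargets

variable {F : T4Family} {G : Type u} [GaugeGroup G] [MeasurableSpace G] [RegularGaugeGroup G] [HaarData G]

/-- **Canonical NE7-HM under the scoping note's β-hypothesis ⇒ THE EXISTENCE TARGET** (through NE7-TV: v1.x's `limit_exists_of_canonicalEffTVRateUnder`).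
[folklore] -/
theorem limit_exists_of_canonicalMeanHybridUnder (D : FiniteEpsData F G) (hM : D.AvgMeasurable)
    (h : CanonicalMeanHybridUnder D hM (BetaPertHyp D.βfun)) : D.ym4_torus_continuum_limit_exists :=
  limit_exists_of_canonicalEffTVRateUnder D hM (canonicalEffTVRateUnder_of_canonicalMeanHybridUnder D hM h)

/-- Print-faithful form (through the limiting law: v1.x's `limit_exists'_of_canonicalLawLimitUnder'`). [folklore] -/
theorem limit_exists'_of_canonicalMeanHybridUnder' (D : FiniteEpsData F G) (hM : D.AvgMeasurable)
    (h : CanonicalMeanHybridUnder D hM (DagBinding.EndpointExistence D.C.toB12)) : D.ym4_torus_continuum_limit_exists' :=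
  limit_exists'_of_canonicalLawLimitUnder' D hM (canonicalLawLimitUnder_of_canonicalMeanHybridUnder D hM h)

/-- **The term-wise socket under the scoping note's β-hypothesis ⇒ THE EXISTENCE TARGET.** [folklore] -/
theorem limit_exists_of_canonicalTermMeanHybridUnder (D : FiniteEpsData F G) (hM : D.AvgMeasurable)
    (h : CanonicalTermMeanHybridUnder D hM (BetaPertHyp D.βfun)) : D.ym4_torus_continuum_limit_exists :=
  limit_exists_of_canonicalMeanHybridUnder D hM (canonicalMeanHybridUnder_of_canonicalTermMeanHybridUnder D hM h)

end MeanHybridTargets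

section MeanHybridSU

variable {F : T4Family} {N : ℕ} [NeZero N] {D : FiniteEpsData F (Matrix.specialUnitaryGroup (Fin N) ℂ)}

/-- **PRINTED-AVERAGED DATA on `SU(N)`: canonical NE7-HM under the prefix ⇒ ALL FOUR TARGETS** (scoping note's form; measurability is the
class's theorem `IsPrintedAveraged.avgMeasurable`). [folklore] -/
theorem printed_targets_of_canonicalMeanHybridUnder (h : D.IsPrintedAveraged)
    (hR : CanonicalMeanHybridUnder D h.avgMeasurable (BetaPertHyp D.βfun)) :
    D.ym4_torus_continuum_limit_exists ∧ D.ym4_torus_continuum_limit_unique ∧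
      D.limit_reflectionPositive ∧ D.limit_torusCovariant :=
  h.targets_of_exists (limit_exists_of_canonicalMeanHybridUnder D h.avgMeasurable hR)

/-- Print-faithful form. [folklore] -/
theorem printed_targets'_of_canonicalMeanHybridUnder' (h : D.IsPrintedAveraged)
    (hR : CanonicalMeanHybridUnder D h.avgMeasurable (DagBinding.EndpointExistence D.C.toB12)) :
    D.ym4_torus_continuum_limit_exists' ∧ D.ym4_torus_continuum_limit_unique' ∧
      D.limit_reflectionPositive' ∧ D.limit_torusCovariant' :=
  h.targets'_of_exists' (limit_exists'_of_canonicalMeanHybridUnder' D h.avgMeasurable hR)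

variable {ℰ : LoopAverage (Matrix.specialUnitaryGroup (Fin N) ℂ)}

/-- **(0.4)-DATA `IsBlockAveraged ℰ`** with a measurable small-loop average: canonical NE7-HM under the prefix ⇒ all four targets. [folklore] -/
theorem blockAvg_targets_of_canonicalMeanHybridUnder (hD : D.IsBlockAveraged ℰ) (hE : ℰ.MeasurableE)
    (hR : CanonicalMeanHybridUnder D (hD.avgMeasurable hE) (BetaPertHyp D.βfun)) :
    D.ym4_torus_continuum_limit_exists ∧ D.ym4_torus_continuum_limit_unique ∧
      D.limit_reflectionPositive ∧ D.limit_torusCovariant :=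
  hD.targets_of_exists hE (limit_exists_of_canonicalMeanHybridUnder D (hD.avgMeasurable hE) hR)

end MeanHybridSU

section MeanHybridHeadline

variable {N : ℕ} [NeZero N]

/-- **`T4Apex.YM4TorusContinuumPrintedSU N` FROM THE CANONICAL MEAN HYBRID FOR ALL PRINTED-AVERAGED DATA** — a statement about the data alone;
CONDITIONAL on the two-class hybrid IN THE MEAN with `Σ r, Σ W, Σ W' < ∞`, i.e. (§4.3) on summable canonical NE7-TV with the tilt relation; the antecedent
is NOT PRINTED for Bałaban's scheme. [folklore] -/
theorem printedSU_of_canonicalMeanHybridUnder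
    (h : ∀ (F : T4Family) (D : FiniteEpsData F (Matrix.specialUnitaryGroup (Fin N) ℂ)) (hP : D.IsPrintedAveraged),
      CanonicalMeanHybridUnder D hP.avgMeasurable (BetaPertHyp D.βfun)) :
    T4Apex.YM4TorusContinuumPrintedSU N :=
  fun F D hD => printed_targets_of_canonicalMeanHybridUnder hD (h F D hD)

end MeanHybridHeadline

/-! ### §4.6 Census conjunction of §4 and the inhabited-vacuous witness -/

section MeanHybridCensus

variable {F : T4Family} {G : Type u} [GaugeGroup G] [MeasurableSpace G] [RegularGaugeGroup G] [HaarData G]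

/-- **CENSUS BY NAME — THE MEAN HYBRID'S PLACE IN THE CANONICAL ORDER** (any `Hβ`): INTO NE7-HM from the term-wise socket, NE7-S, NE7-H (split /
rate clause), NE7-V, NE7-M, NE7-A; NE7-HM ⇔ NE7-TV ∧ tilt; OUT OF NE7-HM to NE7-TV and the limiting law.  No converse into NE7-V / M / S / H claimed;
NE7-A′ / NE7-D / the density chain / NE7-TV alone ⇒ NE7-HM NOT claimed (those shapes present run `K+1`'s law by a density, not as a Gibbs tilt);
antecedents NOT PRINTED. [folklore] -/
theorem meanHybrid_chain (D : FiniteEpsData F G) (hM : D.AvgMeasurable) (Hβ : Prop) :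
    (CanonicalTermMeanHybridUnder D hM Hβ → CanonicalMeanHybridUnder D hM Hβ) ∧
      (CanonicalTiltSandwichUnder D hM Hβ → CanonicalMeanHybridUnder D hM Hβ) ∧
      (CanonicalTermHybridUnder D hM Hβ → CanonicalMeanHybridUnder D hM Hβ) ∧
      (CanonicalTermHybridRateUnder D hM Hβ → CanonicalMeanHybridUnder D hM Hβ) ∧
      (CanonicalPathVarianceUnder D hM Hβ → CanonicalMeanHybridUnder D hM Hβ) ∧
      (CanonicalTiltMomentUnder D hM Hβ → CanonicalMeanHybridUnder D hM Hβ) ∧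
      (CanonicalEffTiltRateUnder D hM Hβ → CanonicalMeanHybridUnder D hM Hβ) ∧
      (CanonicalMeanHybridUnder D hM Hβ ↔ CanonicalEffTVRateTiltUnder D hM Hβ) ∧
      (CanonicalEffTVRateTiltUnder D hM Hβ → CanonicalEffTVRateUnder D hM Hβ) ∧
      (CanonicalMeanHybridUnder D hM Hβ → CanonicalEffTVRateUnder D hM Hβ) ∧
      (CanonicalMeanHybridUnder D hM Hβ → CanonicalLawLimitUnder D hM Hβ) :=
  ⟨canonicalMeanHybridUnder_of_canonicalTermMeanHybridUnder D hM, canonicalMeanHybridUnder_of_canonicalTiltSandwichUnder D hM,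
    canonicalMeanHybridUnder_of_canonicalTermHybridUnder D hM, canonicalMeanHybridUnder_of_canonicalTermHybridRateUnder D hM,
    canonicalMeanHybridUnder_of_canonicalPathVarianceUnder D hM, canonicalMeanHybridUnder_of_canonicalTiltMomentUnder D hM,
    canonicalMeanHybridUnder_of_canonicalEffTiltRateUnder D hM, canonicalMeanHybridUnder_iff_canonicalEffTVRateTiltUnder D hM Hβ,
    canonicalEffTVRateUnder_of_canonicalEffTVRateTiltUnder D hM, canonicalEffTVRateUnder_of_canonicalMeanHybridUnder D hM,
    canonicalLawLimitUnder_of_canonicalMeanHybridUnder D hM⟩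

end MeanHybridCensus

/-- The printed one-level class on `SU(N)` contains, for every `N ≥ 1` and every lattice family, a datum violating (B) at which the mean hybrid, its
term-wise socket and NE7-TV-with-tilt hold under the prefix for every `Hβ` and every measurability witness: inhabited and vacuous, by name
(`T4Apex.exists_isPrintedAveraged₁_not_endStatementBPrinted`) — inhabitation evidence only, no shape holds non-vacuously by this. [folklore] -/
theorem exists_isPrintedAveraged_meanHybrid_vacuous {N : ℕ} [NeZero N] (F : T4Family) (Hβ : Prop) :
    ∃ D : FiniteEpsData F (Matrix.specialUnitaryGroup (Fin N) ℂ), D.IsPrintedAveraged ∧ ¬ B16.EndStatementBPrinted D.C ∧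
      ∀ hM : D.AvgMeasurable, CanonicalMeanHybridUnder D hM Hβ ∧ CanonicalTermMeanHybridUnder D hM Hβ ∧
        CanonicalEffTVRateTiltUnder D hM Hβ := by
  obtain ⟨D, h₁, hB⟩ := T4Apex.exists_isPrintedAveraged₁_not_endStatementBPrinted (N := N) F
  refine ⟨D, h₁.isPrintedAveraged, hB, fun hM => ⟨meanHybrid_of_not_endStatementBPrinted D hM hB Hβ, fun h => absurd h hB, ?_⟩⟩
  exact (canonicalMeanHybridUnder_iff_canonicalEffTVRateTiltUnder D hM Hβ).1 (meanHybrid_of_not_endStatementBPrinted D hM hB Hβ)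

end T4ApexCanonical2

end Literature.MathematicalPhysics.QuantumFieldTheory.Balaban1983to89
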